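import Mathlib
import Summits.Ventures.HodgeRepro2.Tier7.Line1.SepArith
import Summits.Ventures.HodgeRepro2.Tier7.Line1.Defs

/-!
# Tier7/Line1/SepDatum — THE SEPARATING DATUM: `C(D)` holds, `CommonIrred D` fails

The SEPARATING DATUM of t7-L1-p2 (LINE L1, residual probe): a `PeriodDatum` of the FROZEN `Target.lean`
(sha256 6e511b88…, 355 ll.) on which the conclusion `C(D) = ∃ g, ⟨f^*Ω_s, f^*Ω_s̄⟩ ≠ 0` holds (with `g = 1` the
pairing is `1`) while `CommonIrred D` of `Line1/Defs.lean` fails: `P_A = ι(W⁰ ⊗ ℂ²)` and `P_B = ι(Wˢ ⊗ ℂ²)` are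
independent. So over the abstract datum `C(D) → CommonIrred D` is FALSE (`not_conclusion_imp_commonIrred`) — the
residual `R_CommonIrred` of LINE L1 is not a consequence of `C(D)` without a displayed hypothesis (p5's
`OrthDistinct`: it fails here, the two irreducibles pair non-trivially).
The datum: `HX = HXS (H1C K7)`, `G = FreeGroup (Bool × Option ℕ)`, the shadow of `SepShadow`, the arithmetic of
`SepArith` (K7, the face, `s`, `e i` of the datum of record), `alb = Λ + junk ∘ πE` (`e i ↦ θ_i`, the other
eigenlines into the junk), `ω = ![ιA(W⁰), E2, ιA(Wˢ), E2]`.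
Author: t7-L1-p2 (prover-pub-hodge-repro2-t7-L1-p2-g0-0). §8(d): NO.
-/

namespace Summit.Ventures.HodgeRepro2.Tier7.Line1.Sep

open Summit.Ventures.HodgeRepro2 Summit.Ventures.HodgeRepro2.T6 Summit.Ventures.HodgeRepro2.Tier7
open Finset

noncomputable section

/-- the cohomology algebra of the datum: junk `J = H1C K7` -/
abbrev HXK := HXS (H1C K7)

/-! ## The Albanese map -/

/-- the four theta classes `θ₀ = δ_∅, θ₁ = e₀, θ₂ = Φ, θ₃ = e₀ + e₁` -/
def th : Fin 4 → HXK :=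
  ![ιA (wtU 0 Wmod_zero_le_Usub), eH 0, ιA (wtU sq Wmod_sq_le_Usub), eH 0 + eH 1]

/-- `θ₀` -/
@[simp] theorem th_zero : th 0 = ιA (wtU 0 Wmod_zero_le_Usub) := rfl
/-- `θ₁` -/
@[simp] theorem th_one : th 1 = eH 0 := rfl
/-- `θ₂` -/
@[simp] theorem th_two : th 2 = ιA (wtU sq Wmod_sq_le_Usub) := rfl
/-- `θ₃` -/
@[simp] theorem th_three : th 3 = eH 0 + eH 1 := rfl

/-- the theta classes lie in `H10` -/
theorem th_mem_H10 (i : Fin 4) : th i ∈ (H10 : Submodule ℂ HXK) := by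
  fin_cases i
  · exact ιA_mem_H10 _
  · exact eH_mem_H10 0
  · exact ιA_mem_H10 _
  · exact H10.add_mem (eH_mem_H10 0) (eH_mem_H10 1)

/-- the junk component of a theta class vanishes -/
theorem th_j (i : Fin 4) : (th i).j = 0 := by
  fin_cases i <;> simp [th, ιA, eH]

/-- the holomorphic part of the Albanese map: `e i ↦ θ_i`, the other eigenlines `↦ 0` -/
def Λ : H1C K7 →ₗ[ℂ] HXK := ∑ i, (coordE i).smulRight (th i)

/-- `Λ` unfolded -/
theorem Λ_apply (v : H1C K7) : Λ v = ∑ i, coordE i v • th i := by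
  simp [Λ, LinearMap.sum_apply]

/-- the projection killing the span of the `e i` -/
def πE : H1C K7 →ₗ[ℂ] H1C K7 := LinearMap.id - ∑ i, (coordE i).smulRight (eJ i)

/-- `πE` unfolded -/
theorem πE_apply (v : H1C K7) : πE v = v - ∑ i, coordE i v • eJ i := by
  simp [πE, LinearMap.sum_apply]

/-- the junk inclusion -/
def ofJK : H1C K7 →ₗ[ℂ] HXK :=
  (Curve.ofJ (R := A₁) (V := V₂) (β := β₂)).comp (Junk.mk (J := H1C K7))

/-- `ofJK` unfolded -/
theorem ofJK_apply (j : H1C K7) : ofJK j = ⟨0, 0, 0, Junk.mk j⟩ := rfl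

/-- the Albanese map -/
def albS : H1C K7 →ₗ[ℂ] HXK := Λ + ofJK.comp πE

/-- `Λ (e i) = θ_i` -/
theorem Λ_eJ (i : Fin 4) : Λ (eJ i) = th i := by
  simp [Λ_apply, coordE_eJ, ite_smul]

/-- `πE (e i) = 0` -/
theorem πE_eJ (i : Fin 4) : πE (eJ i) = 0 := by
  simp [πE_apply, coordE_eJ, ite_smul]

/-- `alb (e i) = θ_i` -/
theorem albS_eJ (i : Fin 4) : albS (eJ i) = th i := by
  simp [albS, Λ_eJ, πE_eJ]

/-- the junk component of `Λ v` vanishes -/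
theorem Λ_j (v : H1C K7) : (Λ v).j = 0 := by
  have := map_sum (Curve.jL (R := A₁) (V := V₂) (J := Junk (H1C K7)) (β := β₂))
    (fun i => coordE i v • th i) Finset.univ
  simp only [Curve.jL_apply, map_smul, th_j, smul_zero, Finset.sum_const_zero] at this
  rw [Λ_apply]
  exact this

/-- the junk component of `alb v` is `πE v` -/
theorem albS_j (v : H1C K7) : (albS v).j = Junk.mk (πE v) := by
  simp [albS, Λ_j, ofJK_apply]

/-- the junk lies in `H10` -/
theorem ofJK_mem_H10 (j : H1C K7) : ofJK j ∈ (H10 : Submodule ℂ HXK) :=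
  mem_H10.2 ⟨⟨0, by simp [ofJK_apply, holA_zero]⟩, ⟨0, by simp [ofJK_apply]⟩, rfl, rfl⟩

/-- `alb` lands in `H10` -/
theorem albS_mem_H10 (v : H1C K7) : albS v ∈ (H10 : Submodule ℂ HXK) := by
  rw [albS, LinearMap.add_apply, LinearMap.comp_apply, Λ_apply]
  exact H10.add_mem (Submodule.sum_mem _ fun i _ => H10.smul_mem _ (th_mem_H10 i)) (ofJK_mem_H10 _)

/-- the theta classes are linearly independent -/
theorem th_linearIndependent (c : Fin 4 → ℂ) (h : ∑ i, c i • th i = 0) : ∀ i, c i = 0 := by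
  rw [Fin.sum_univ_four, th_zero, th_one, th_two, th_three] at h
  -- the first-curve components
  have hc := congrArg Curve.c h
  simp only [Curve.add_c, Curve.smul_c, ιA, eH, smul_zero, add_zero, Curve.zero_c] at hc
  rw [← holA_smul, ← holA_smul, ← holA_add, ← holA_zero] at hc
  have hU := holA_injective hc
  have hU' := congrArg Subtype.val hU
  simp only [Submodule.coe_add, Submodule.coe_smul, wtU, Submodule.coe_zero] at hU'
  have h0 : c 0 • wt 0 ∈ Wmod 0 ⊓ Wmod sq := by
    refine ⟨(Wmod 0).smul_mem _ (level_le_Wmod 0 ∅ (wt_mem_level 0)), ?_⟩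
    have : c 0 • wt 0 = -(c 2 • wt sq) := eq_neg_of_add_eq_zero_left hU'
    rw [this]
    exact (Wmod sq).neg_mem ((Wmod sq).smul_mem _ (level_le_Wmod sq ∅ (wt_mem_level sq)))
  rw [Wmod_zero_inf_eq_bot sq_ne_zero, Submodule.mem_bot] at h0
  have hc0 : c 0 = 0 := (smul_eq_zero.1 h0).resolve_right (wt_ne_zero 0)
  have h2 : c 2 • wt sq = 0 := by rw [hc0, zero_smul, zero_add] at hU'; exact hU'
  have hc2 : c 2 = 0 := (smul_eq_zero.1 h2).resolve_right (wt_ne_zero sq)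
  -- the second-curve components
  have hv := congrArg (fun x : HXK => x.v.1) h
  simp only [Curve.add_v, Curve.smul_v, ιA, eH, Prod.fst_add, Prod.smul_fst, smul_zero, add_zero, zero_add,
    Curve.zero_v, Prod.fst_zero] at hv
  have hv0 := congrFun hv 0
  have hv1 := congrFun hv 1
  simp only [Pi.add_apply, Pi.smul_apply, Pi.single_eq_same, Pi.single_eq_of_ne (show (1 : Fin 2) ≠ 0 by decide),
    Pi.single_eq_of_ne (show (0 : Fin 2) ≠ 1 by decide), smul_zero, add_zero, zero_add, Pi.zero_apply] at hv0 hv1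
  have hc3 : c 3 = 0 := by
    have := congrArg Curve.c hv1
    simpa using this
  have hc1 : c 1 = 0 := by
    have := congrArg Curve.c hv0
    simp [hc3] at this
    exact this
  intro i
  fin_cases i <;> assumption

/-- `alb` is injective -/
theorem albS_injective : Function.Injective albS := by
  intro v w hvw
  rw [← sub_eq_zero, ← map_sub] at hvw
  set u := v - w with hu
  have hπ : πE u = 0 := by
    have := congrArg Curve.j hvw
    rw [albS_j] at this
    exact this
  have hrepr : u = ∑ i, coordE i u • eJ i := by
    rw [πE_apply, sub_eq_zero] at hπ
    exact hπ
  have hΛ : Λ u = 0 := by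
    have h := hvw
    rw [albS, LinearMap.add_apply, LinearMap.comp_apply, hπ, map_zero, add_zero] at h
    exact h
  have hsum : ∑ i, coordE i u • th i = 0 := by
    rw [Λ_apply] at hΛ; exact hΛ
  have hc := th_linearIndependent _ hsum
  rw [← sub_eq_zero, ← hu, hrepr]
  simp [hc]

/-! ## The datum -/

/-- the theta-lift summands `ω = ![ιA(W⁰), E2, ιA(Wˢ), E2]` -/
def omegaS : Fin 4 → Submodule ℂ HXK := ![omegaA 0, E2, omegaA sq, E2]

/-- `ω₀` -/
@[simp] theorem omegaS_zero : omegaS 0 = omegaA 0 := rfl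
/-- `ω₁` -/
@[simp] theorem omegaS_one : omegaS 1 = E2 := rfl
/-- `ω₂` -/
@[simp] theorem omegaS_two : omegaS 2 = omegaA sq := rfl
/-- `ω₃` -/
@[simp] theorem omegaS_three : omegaS 3 = E2 := rfl

/-- THE SEPARATING DATUM -/
def datumS : PeriodDatum K7 K7 (Fin 3 → K7) HXK G where
  E := cmK7
  Vh := hermK7
  S := shadow jbK
  F := faceJ
  alb := albS
  alb_inj := albS_injective
  alb_h10 := fun v _ => albS_mem_H10 v
  s := sJ
  hs0 := sJ_mem0
  hs1 := sJ_mem1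
  hs2 := sbar_mem2
  hs3 := sbar_mem3
  e := eJ
  e0_mem := A1EigenGen.eGen_mem K7 sJ 0
  e1_mem := A1EigenGen.eGen_mem K7 sJ 1
  e2_mem := A1EigenGen.eGen_mem K7 _ 2
  e3_mem := A1EigenGen.eGen_mem K7 _ 3
  e_ne := fun i => A1EigenGen.eGen_ne_zero K7 _ _
  omega := omegaS
  omega_le := by
    intro i
    fin_cases i
    · exact omegaA_le_H10 0
    · exact E2_le_H10
    · exact omegaA_le_H10 sq
    · exact E2_le_H10
  omega_irred := by
    intro i
    fin_cases i
    · exact heckeIrred_omegaA 0 Wmod_zero_le_Usub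
    · exact heckeIrred_E2
    · exact heckeIrred_omegaA sq Wmod_sq_le_Usub
    · exact heckeIrred_E2
  theta_mem := by
    intro i
    rw [albS_eJ]
    fin_cases i
    · exact ιA_mem_omegaA (wtU_mem_WU 0 _)
    · exact eH_mem_E2 0
    · exact ιA_mem_omegaA (wtU_mem_WU sq _)
    · exact E2.add_mem (eH_mem_E2 0) (eH_mem_E2 1)
  center_scalar := by
    intro i z hz
    fin_cases i
    · exact exists_scalar_omegaA hz 0 Wmod_zero_le_Usub
    · exact exists_scalar_E2 hz
    · exact exists_scalar_omegaA hz sq Wmod_sq_le_Usub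
    · exact exists_scalar_E2 hz
  center_match := by
    intro z _ a ha
    exact center_fixes_prod jbK z (ha 0) (ha 1) (ha 2) (ha 3)
  disc := fun _ => 1
  disc_plus := fun _ => map_one conjK7
  disc_ne := fun _ => one_ne_zero
  disc_match := ⟨1, one_ne_zero, by simp⟩

/-! ## `C(D)` holds: the pairing at `g = 1` is `1` -/

/-- `⟨δ_∅, Φ̄⟩ = Φ(∅) = 1` -/
theorem Bform_wt : Bform (wtU 0 Wmod_zero_le_Usub) (conjU (wtU sq Wmod_sq_le_Usub)) = 1 := by
  rw [Bform_eq_tsum, tsum_eq_single ∅]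
  · simp [wtU, conjF]
  · intro ω hω
    obtain ⟨n, hn⟩ := Finset.nonempty_iff_ne_empty.2 hω
    simp [wtU, wt_zero_of_mem hn]

/-- the product of the four theta classes -/
theorem th_prod : th 0 * th 1 * barH jbK (th 2 * th 3) = (1 : ℂ) • topT := by
  rw [th_zero, th_one, th_two, th_three]
  rw [barH_mul, show ιA (wtU 0 Wmod_zero_le_Usub) * eH 0 * (barH jbK (ιA (wtU sq Wmod_sq_le_Usub)) *
      barH jbK (eH 0 + eH 1)) = (ιA (wtU 0 Wmod_zero_le_Usub) * barH jbK (ιA (wtU sq Wmod_sq_le_Usub))) *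
      (eH 0 * barH jbK (eH 0 + eH 1)) by ring, ιA_mul_barH_ιA, Bform_wt, barH_add, barH_eH, barH_eH,
    mul_add, eH_mul_eHbar, eH_mul_eHbar, if_pos rfl, if_neg (by decide), add_zero, one_smul,
    incA_topA_mul_topH, one_smul]

/-- THE PAIRING at `g = 1` is `1` -/
theorem pairing_one : datumS.S.L2 (datumS.fOmegaS 1) (datumS.fOmegaSbar 1) = 1 := by
  simp only [PeriodDatum.fOmegaS, PeriodDatum.fOmegaSbar, PeriodDatum.theta, datumS, Pi.one_apply, one_smul,
    albS_eJ]
  rw [shadow_L2, th_prod, one_smul, intX_topT]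

/-- `C(D)`: the conclusion of `P_T7` holds for the separating datum -/
theorem conclusion_datumS : ∃ g : Fin 4 → G, datumS.S.L2 (datumS.fOmegaS g) (datumS.fOmegaSbar g) ≠ 0 :=
  ⟨1, by rw [pairing_one]; exact one_ne_zero⟩

/-! ## `CommonIrred D` fails: `P_A ⊓ P_B = ⊥` -/

/-- `ιA u * e k = ι (single k u)` -/
theorem ιA_mul_eH_eq_ι (u : U) (k : Fin 2) : (ιA u : HXK) * eH k = ι (Pi.single k u) := by
  rw [ιA_mul_eH, ι_apply]
  refine Curve.ext rfl (Prod.ext (funext fun j => ?_) rfl) rfl rfl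
  simp only [Pi.single_apply]
  split_ifs <;> simp [holA_zero]

/-- `ιA u * b ∈ ι(PW s)` for `u ∈ WU s`, `b ∈ E2` -/
theorem ιA_mul_E2_mem (s : ℕ → ℂ) {u : U} (hu : u ∈ WU s) {b : HXK} (hb : b ∈ E2) :
    ιA u * b ∈ (PW s).map ι := by
  obtain ⟨p, q, rfl⟩ := Submodule.mem_span_pair.1 hb
  rw [mul_add, mul_smul_comm, mul_smul_comm, ιA_mul_eH_eq_ι, ιA_mul_eH_eq_ι, ← map_smul, ← map_smul,
    ← map_add]
  refine Submodule.mem_map_of_mem (mem_PW.2 fun k => ?_)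
  fin_cases k
  · simpa using (Wmod s).smul_mem p hu
  · simpa using (Wmod s).smul_mem q hu

/-- `P_A ≤ ι(PW 0)` -/
theorem prodModS_le : Line1.prodModS datumS ≤ (PW 0).map ι := by
  rw [Line1.prodModS, Submodule.span_le]
  rintro _ ⟨g, rfl⟩
  show datumS.fOmegaS g ∈ _
  simp only [PeriodDatum.fOmegaS, PeriodDatum.theta, datumS, albS_eJ, th_zero, th_one]
  rw [smul_ιA]
  exact ιA_mul_E2_mem 0 (smul_mem_WU 0 _ (wtU_mem_WU 0 _)) (heckeStable_E2 _ _ (eH_mem_E2 0))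

/-- `P_B ≤ ι(PW sq)` -/
theorem prodModSbar_le : Line1.prodModSbar datumS ≤ (PW sq).map ι := by
  rw [Line1.prodModSbar, Submodule.span_le]
  rintro _ ⟨g, rfl⟩
  show datumS.fOmegaSbar g ∈ _
  simp only [PeriodDatum.fOmegaSbar, PeriodDatum.theta, datumS, albS_eJ, th_two, th_three]
  rw [smul_ιA]
  exact ιA_mul_E2_mem sq (smul_mem_WU sq _ (wtU_mem_WU sq _))
    (heckeStable_E2 _ _ (E2.add_mem (eH_mem_E2 0) (eH_mem_E2 1)))

/-- `P_A ⊓ P_B = ⊥` -/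
theorem inf_eq_bot : Line1.prodModS datumS ⊓ Line1.prodModSbar datumS = ⊥ :=
  le_bot_iff.1 ((inf_le_inf prodModS_le prodModSbar_le).trans map_PW_inf.le)

/-- `CommonIrred D` FAILS for the separating datum -/
theorem not_commonIrred : ¬ Line1.CommonIrred datumS := fun h =>
  (Line1.commonIrred_iff_inf_ne_bot datumS).1 h inf_eq_bot

/-- THE SEPARATION: `C(D)` holds and `CommonIrred D` fails -/
theorem separating :
    (∃ g : Fin 4 → G, datumS.S.L2 (datumS.fOmegaS g) (datumS.fOmegaSbar g) ≠ 0) ∧ ¬ Line1.CommonIrred datumS :=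
  ⟨conclusion_datumS, not_commonIrred⟩

/-- THE RESIDUAL PROBE: over the abstract datum, `C(D) → CommonIrred D` is FALSE -/
theorem not_conclusion_imp_commonIrred :
    ¬ ∀ (K : Type) [Field K] [NumberField K] (E' : Type) [Field E'] [NumberField E']
      (V : Type) [AddCommGroup V] [Module E' V] (HX : Type) [Ring HX] [Algebra ℂ HX]
      (G : Type) [Group G] [MulAction G HX] (D : PeriodDatum K E' V HX G),
      (∃ g : Fin 4 → G, D.S.L2 (D.fOmegaS g) (D.fOmegaSbar g) ≠ 0) → Line1.CommonIrred D :=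
  fun h => not_commonIrred (h K7 K7 (Fin 3 → K7) HXK G datumS conclusion_datumS)

end

end Summit.Ventures.HodgeRepro2.Tier7.Line1.Sep
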